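import Literature.Geometry.Riemannian.LowEntropyHypersurfacesFourNeckSurgery
import HarnessLib

/-!
# Low-entropy hypersurfaces of `ℝ⁵`: the flow with surgery along necks exists
# (Chodosh–Mantoulidis–Schulze 2025, Thm. 1.13 / Cor. 1.19 with Daniels-Holgate 2022, Thm. 1.3)

Topic `Geometry/Riemannian`.  ONE named fact, no `sorry`, no new definition: the ANALYTIC input of
Cor. 1.5 (b) of O. Chodosh, C. Mantoulidis, F. Schulze, *Mean curvature flow with generic
low-entropy initial data II*, Duke Math. J. 174 (2025) = arXiv:2309.03856, for `n = 4`, in the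
vocabulary of `LowEntropyHypersurfacesFourNeckSurgery.lean` (`MCFNeckSurgeryFlowFrom`: a classical
mean curvature flow runs from the hypersurface to a first stopping time whose slice is resolved by
finitely many further flows, neck replacements by standard caps attached along the necks, and
discarded `𝕊⁴` / `𝕊³ × 𝕊¹` components — the Daniels-Holgate flow with surgery).  It is, VERBATIM,
the hypothesis `hflow` of the accepted reduction
`ChodoshMantoulidisSchulze2025_cor15b_four_of_neckSurgeryFlow` (loc. cit., PROVED, no input from
Cerf's `Γ₄ = 0`), so that with this leaf

  `ChodoshMantoulidisSchulze2025_cor15b_four_of_neckSurgeryFlow h :`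
  `  ChodoshMantoulidisSchulze2025_cor15b_four`

for `h : ChodoshMantoulidisSchulze2025_neckSurgeryFlow_four`, and likewise
`ChodoshMantoulidisSchulze2025_lowEntropy_sphere_four_of_flows ha h` for the parent fact.  Vendored
on request (promote event 3792801; the provefact unit of `…cor15b_four` may not mint facts, D-0026).

## The printed statements

* CMS 2025, **Cor. 1.5** (p. 3): "Let `n ∈ {2, 3, 4, 5}` and `Mⁿ ⊂ ℝⁿ⁺¹` be a closed connected
  embedded hypersurface. … (b) If `λ(M) ≤ λ(𝕊ⁿ⁻²)` then perhaps after a small initial `C^∞`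
  perturbation, the mean curvature flow with surgery of [Daniels-Holgate] … provides a smooth
  isotopy from `M` to the boundary of a standard handlebody that is either a standard ball `Bⁿ` or
  a boundary connect sum of finitely many `Bⁿ⁻¹ × 𝕊¹`'s."  **Cor. 1.22** (p. 6) is the same under
  the hypotheses (◇), (♥) on `Λ`, which hold unconditionally for `n ≤ 5` (Rem. 1.16, 1.17), and
  its **proof** (p. 6): "either `M` is a round sphere (in which case we are done), or we can find a
  small `C^∞` graph `M'` over `M` so that `λ(M') < Λ` and so that there is `ℳ' ∈ 𝔉(M')` with
  `sing_non-gen ℳ' = ∅` [**Thm. 1.13** / **Cor. 1.19**]. … In case (b), we additionally use the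
  surgery of [Daniels-Holgate]."
* Daniels-Holgate 2022, **Thm. 1.3** (Adv. Math. 410, p. 3): from a closed embedded hypersurface
  whose level-set flow has only multiplicity-one spherical and neck-pinch singularities "there is
  a smooth flow with surgery that exists until the flow vanishes"; **Def. 2.18–2.20, 2.26** (the
  flow with surgery: finitely many smooth flows, at each stopping time disjoint strong `δ`-necks
  replaced by pairs of standard caps continuing the round cylinder of the neck, then some
  components discarded) and **Thm. 2.29** ("all discarded components are diffeomorphic to `D̄ⁿ⁺¹`
  or `D̄ⁿ × 𝕊¹`").

## How the typed statement reads them (for `n = 4`, every closed connected `M`)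

For every closed connected embedded `ι : M⁴ ↪ ℝ⁵` (`T2`, second countable, compact, connected
`C^∞` manifold modelled on `ℝ⁴`; `Manifold.IsSmoothEmbedding`) with
`λ(ι(M)) ≤ λ(𝕊²(2) × ℝ²)` (`gaussianEntropy 4`, `shrinkingCylinder 4 2`; `= λ(𝕊²) = λ(𝕊ⁿ⁻²)`):
EITHER `range ι` is a round sphere `sphere c r`, `r > 0` ("in which case we are done"), OR for
every `ε > 0` there is a `C^∞` embedding `ι₁ : M → ℝ⁵` with `‖ι₁ x − ι x‖ ≤ ε` for all `x` (the
small `C^∞` graph `M'`, an embedded copy of `M`; only `C⁰`-closeness is recorded),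
`λ(ι₁(M)) < λ(𝕊²(2) × ℝ²)` (the entropy drop `λ(M') < Λ`), and `MCFNeckSurgeryFlowFrom M ι₁`
(Thm. 1.13 gives `sing_non-gen = ∅`; with `λ < λ(𝕊²)` only multiplicity-one `𝕊⁴`- and
`𝕊³ × ℝ`-type singularities remain, Rem. 1.9, so Daniels-Holgate's Thm. 1.3 applies and its flow
with surgery is a term of the inductive rendering, see the module docstring of
`LowEntropyHypersurfacesFourNeckSurgery.lean`, "The printed proof, and the two renderings").
Stated for ALL closed connected `M`, as printed (the simply connected conclusion `M ≅ 𝕊⁴` of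
`…cor15b_four` is the tree's proved consequence).  The proofs are the Brakke-flow analysis of the
two cited papers, absent from Mathlib and from the tree.

## References

* [ChodoshMantoulidisSchulze2025] Duke Math. J. 174 (2025), arXiv:2309.03856: Cor. 1.5 (b) p. 3,
  Rem. 1.9, Thm. 1.13, Rem. 1.16–1.17, Cor. 1.19, Cor. 1.22 (b) and its proof, §1.6 p. 6.
* [DanielsHolgate2022] Adv. Math. 410 (2022) 108715, arXiv:2104.11647: Thm. 1.3, Def. 2.18–2.20,
  Def. 2.26, Thm. 2.29.
* [HaslhoferKleiner2017] Duke Math. J. 166 (2017) 1591–1626 (the surgery formalism recalled by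
  Daniels-Holgate, §2.1).
-/

noncomputable section

open Set Function Metric

open scoped Manifold ContDiff

namespace Literature.Geometry.Riemannian

/-- Local notation: `𝔼 n` is the model Euclidean space `EuclideanSpace ℝ (Fin n)`. -/
local notation "𝔼 " n:arg => EuclideanSpace ℝ (Fin n)

/-- **Chodosh–Mantoulidis–Schulze 2025 (Thm. 1.13 / Cor. 1.19, proof of Cor. 1.22 (b)) with
Daniels-Holgate 2022 (Thm. 1.3, Thm. 2.29), `n = 4`: the mean curvature flow with surgery along
necks exists from a small perturbation of every non-round closed connected hypersurface of `ℝ⁵`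
of entropy at most `λ(𝕊² × ℝ²)`.**  For every closed connected embedded `ι : M⁴ ↪ ℝ⁵` with
`λ(ι(M)) ≤ λ(𝕊²(2) × ℝ²)`: either `range ι` is a round sphere, or for every `ε > 0` there is a
`C^∞` embedding `ι₁ : M → ℝ⁵`, `ε`-close to `ι` in `C⁰`, with `λ(ι₁(M)) < λ(𝕊²(2) × ℝ²)` and
`MCFNeckSurgeryFlowFrom M ι₁`.  Verbatim the hypothesis `hflow` of
`ChodoshMantoulidisSchulze2025_cor15b_four_of_neckSurgeryFlow`; reading of every clause in the
module docstring.
[cite: ChodoshMantoulidisSchulze2025, Thm 1.13, Cor 1.19, Rem 1.9, Cor 1.5(b), Cor 1.22(b), p. 6]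
[cite: DanielsHolgate2022, Thm. 1.3, Def. 2.18–2.20, Def. 2.26, Thm. 2.29] -/
def ChodoshMantoulidisSchulze2025_neckSurgeryFlow_four : Prop :=
  ∀ (M : Type) [TopologicalSpace M] [T2Space M] [SecondCountableTopology M]
    [CompactSpace M] [ConnectedSpace M] [ChartedSpace (𝔼 4) M] [IsManifold (𝓡 4) ∞ M]
    (ι : M → 𝔼 5), Manifold.IsSmoothEmbedding (𝓡 4) (𝓡 5) ∞ ι →
    gaussianEntropy 4 (range ι) ≤ gaussianEntropy 4 (shrinkingCylinder 4 2) →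
    (∃ (c : 𝔼 5) (r : ℝ), 0 < r ∧ range ι = Metric.sphere c r) ∨
    ∀ ε : ℝ, 0 < ε → ∃ ι₁ : M → 𝔼 5, Manifold.IsSmoothEmbedding (𝓡 4) (𝓡 5) ∞ ι₁ ∧
      (∀ x, ‖ι₁ x - ι x‖ ≤ ε) ∧
      gaussianEntropy 4 (range ι₁) < gaussianEntropy 4 (shrinkingCylinder 4 2) ∧
      MCFNeckSurgeryFlowFrom M ι₁

/-- **Cor. 1.5 (b) of CMS 2025 for `n = 4`, simply connected case, modulo the single analytic
leaf**: `ChodoshMantoulidisSchulze2025_cor15b_four` from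
`ChodoshMantoulidisSchulze2025_neckSurgeryFlow_four` (the tree's proved, Cerf-free reduction).
[cite: ChodoshMantoulidisSchulze2025, Cor. 1.5 (b), Cor. 1.22 (b) and proof (§1.6, p. 6)] -/
theorem ChodoshMantoulidisSchulze2025_cor15b_four_of_neckSurgeryFlow_four
    (h : ChodoshMantoulidisSchulze2025_neckSurgeryFlow_four) :
    ChodoshMantoulidisSchulze2025_cor15b_four :=
  ChodoshMantoulidisSchulze2025_cor15b_four_of_neckSurgeryFlow h

/-- **Cor. 1.5 of CMS 2025 for `n = 4` (both halves) modulo the two flow leaves**: the parent fact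
`ChodoshMantoulidisSchulze2025_lowEntropy_sphere_four` from the smooth flow to a round point (a)
and the flow with surgery along necks (b).
[cite: ChodoshMantoulidisSchulze2025, Cor. 1.5 (a), (b), Cor. 1.22 and proof p. 6] -/
theorem ChodoshMantoulidisSchulze2025_lowEntropy_sphere_four_of_neckSurgeryFlow_four
    (ha : ChodoshMantoulidisSchulze2025_smoothFlow_roundPoint_four)
    (h : ChodoshMantoulidisSchulze2025_neckSurgeryFlow_four) :
    ChodoshMantoulidisSchulze2025_lowEntropy_sphere_four :=
  ChodoshMantoulidisSchulze2025_lowEntropy_sphere_four_of_flows ha h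

end Literature.Geometry.Riemannian

end
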